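import Literature.Analysis.FluidPDE.DoeringFoias
import Literature.Analysis.FluidPDE.ZerothLawProofs
import Literature.Analysis.FluidPDE.LerayHopfSpectralMeasurability
import Literature.Analysis.FluidPDE.CheskidovAssemblyTools
import Literature.Analysis.FluidPDE.LongTimeAverageNonneg
import Literature.Analysis.FunctionSpaces.TorusVectorParseval
import HarnessLib

/-!
# Doering–Foias power bound `⟨f·u⟩ ≤ F U`: proof of `DoeringFoias2002_power_le`

Second sibling proof file of `Literature.Analysis.FluidPDE.DoeringFoias` (the first,
`Literature.Analysis.FluidPDE.DoeringFoiasProofs`, discharges the power-balance inequality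
`DoeringFoias2002_dissipation_le_power`; the two files are independent). It discharges the named
fact `Literature.Analysis.FluidPDE.DoeringFoias2002_power_le` (Cheskidov–Doering–Petrov 2007,
eq. (17) with `α = 0`; Doering–Foias 2002, §2): for the steady force `f(x) = F Φ(x/ℓ)`,
`ℓ = 1/n`, and every global Leray–Hopf solution `u` of the Navier–Stokes equations on `T³`,
`⟨f·u⟩ ≤ |F| U` with `U = ⟨‖u‖₂²⟩^{1/2}` and `limsup` long-time averages
(`DoeringFoias2002_power_le_holds`).

## The printed proof and its Lean rendering

Cheskidov–Doering–Petrov (display before eq. (17), `α = 0`): by Cauchy–Schwarz in space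
`|∫ f·u(t) dx| ≤ ‖f‖₂ ‖u(t)‖₂ = F ‖u(t)‖₂`, then time average and Jensen,
`⟨f·u⟩ ≤ F · (time average of ‖u‖₂) ≤ F U`; p. 6: with `lim sup` in place of `lim` "the
estimates we derive are fully applicable to weak solutions". In Lean the averages are the
`limsup`s of the Cesàro means `T⁻¹∫₀ᵀ` (`longTimeAvgSup`, junk value `0` when the means are
unbounded), so the honest rendering of the last step needs the Cesàro means of the energy
`T⁻¹∫₀ᵀ ‖u‖₂²` to be *bounded* — the standard a-priori estimate, which we prove from the
`Torus.IsLerayHopfOn` clauses: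

* `ofReal_integral_norm_sq_le_eGradNormSq_add` — spectral Poincaré inequality on `T^d`,
  `4π²‖v‖₂² ≤ ‖∇v‖₂² + 4π²‖∫v‖²` (Parseval, `Torus.tsum_enorm_sq_mFourierCoeff_complexify`);
* `Torus.IsGlobalLerayHopf.integral_inner_const_eq` / `integral_eq_integral` — the mean flow
  `∫ u(t)` is conserved for a steady smooth mean-zero force (time-sliced weak formulation
  `Torus.IsLerayHopfOn.integral_inner_eq_add_setIntegral` tested with constant fields);
* `Torus.IsGlobalLerayHopf.intervalIntegral_norm_sq_le`, `timeMean_norm_sq_le` — energy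
  inequality from `0` + Young + integrated Poincaré give `∫₀ᵗ‖u‖₂² ≤ C₀ + C₁ t`, hence bounded
  Cesàro means;
* `Torus.IsGlobalLerayHopf.abs_timeMean_power_le` — `|T⁻¹∫₀ᵀ⟨f,u⟩| ≤ ‖f‖₂ (T⁻¹∫₀ᵀ‖u‖₂²)^{1/2}`
  (Cauchy–Schwarz in space, `abs_integral_inner_le_sqrt_mul_sqrt`, and Jensen in time in the
  elementary form `√e ≤ e/(2a) + a/2`, optimised over `a > 0`);
* `Torus.IsGlobalLerayHopf.meanPower_le` — `⟨f·u⟩ ≤ ‖f‖₂ U` for every steady smooth mean-zero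
  force in every dimension (`limsup` passes through the monotone continuous `y ↦ ‖f‖₂ √y`,
  `Monotone.map_limsup_of_continuousAt`), and the discharge for `f = F Φ(n • ·)`, `‖f‖₂ = |F|`
  (`ForcingShape.integral_norm_sq_force_holds`).

No mean-zero hypothesis on the datum is needed (the conserved mean only enlarges `U`), exactly as
in the vendored statement.

## References

* A. Cheskidov, C. R. Doering, N. P. Petrov, *Energy dissipation in fractal-forced flow*,
  J. Math. Phys. 48 (2007) 065208, arXiv:physics/0607280, §II (p. 6, `lim sup` remark; eq. (12),
  Poincaré), §III display before eq. (17) and eq. (17).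
* C. R. Doering, C. Foias, *Energy dissipation in body-forced turbulence*, J. Fluid Mech. 467
  (2002), 289–306, §2.
* R. Temam, *Navier–Stokes Equations*, 3rd ed. (1984), Ch. III §1.1, (1.22)–(1.25) (time-sliced
  weak formulation, as used through `Literature.Analysis.FluidPDE.LerayHopfTimeSliceTorus`).
-/

open MeasureTheory Filter Set UnitAddTorus
open scoped ENNReal NNReal RealInnerProductSpace

noncomputable section

namespace Literature.Analysis.FluidPDE

variable {d : Type*} [Fintype d]

/-! ### A spectral Poincaré inequality on `T^d` -/

section Poincare

/-- A nonzero integer frequency has `|k|² ≥ 1`. [folklore] -/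
theorem one_le_freqNormSq_of_ne_zero {k : d → ℤ} (hk : k ≠ 0) :
    1 ≤ FunctionSpaces.Torus.freqNormSq k := by
  obtain ⟨i, hi⟩ : ∃ i, k i ≠ 0 := by
    by_contra h
    push Not at h
    exact hk (funext h)
  have h1 : (1 : ℝ) ≤ (k i : ℝ) ^ 2 := by
    have h' : (1 : ℤ) ≤ |k i| := Int.one_le_abs hi
    have h'' : (1 : ℝ) ≤ |(k i : ℝ)| := by exact_mod_cast h'
    nlinarith [abs_nonneg (k i : ℝ), sq_abs (k i : ℝ)]
  unfold FunctionSpaces.Torus.freqNormSq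
  exact h1.trans (Finset.single_le_sum (fun j _ => sq_nonneg (k j : ℝ)) (Finset.mem_univ i))

/-- The zeroth Fourier coefficient of a complexified real vector field is its complexified mean
`𝓕(complexify ∘ v)(0) = complexify (∫ v)` (`e₀ = 1`; the complexification is a linear isometry
and commutes with the Bochner integral). [folklore] -/
theorem mFourierCoeff_complexify_zero (v : UnitAddTorus d → EuclideanSpace ℝ d) :
    mFourierCoeff (FunctionSpaces.EuclideanSpace.complexify ∘ v) 0 =
      FunctionSpaces.EuclideanSpace.complexify (∫ x, v x) := by
  rw [FunctionSpaces.Torus.mFourierCoeff_eq_integral_volume, neg_zero, mFourier_zero]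
  simp only [ContinuousMap.one_apply, one_smul, Function.comp_apply]
  exact FunctionSpaces.EuclideanSpace.complexify.integral_comp_comm v

/-- **Spectral Poincaré inequality on the unit torus** (additive form, in `[0, ∞]`): for
`v ∈ L²(T^d; ℝ^d)`, `4π² ‖v‖₂² ≤ ‖∇v‖₂² + 4π² ‖∫ v‖²`, i.e. `‖∇v‖₂² ≥ 4π² ‖v - v̄‖₂²` with the
spectral gradient norm `Torus.eGradNormSq v = 4π² ∑ₖ |k|² ‖v̂(k)‖²`: by Parseval
`‖v‖₂² = ∑ₖ ‖v̂(k)‖²`, the zero mode is `v̂(0) = ∫ v`, and `|k|² ≥ 1` for `k ≠ 0`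
(the Poincaré inequality on the periodic box behind Cheskidov–Doering–Petrov 2007, eq. (12), and
Doering–Foias 2002, §2). [folklore] -/
theorem ofReal_integral_norm_sq_le_eGradNormSq_add {v : UnitAddTorus d → EuclideanSpace ℝ d}
    (hv : MemLp v 2 volume) :
    ENNReal.ofReal (4 * Real.pi ^ 2 * ∫ x, ‖v x‖ ^ 2) ≤
      FunctionSpaces.Torus.eGradNormSq v + ENNReal.ofReal (4 * Real.pi ^ 2 * ‖∫ x, v x‖ ^ 2) := by
  set a : (d → ℤ) → ℝ≥0∞ :=
    fun k => ‖mFourierCoeff (FunctionSpaces.EuclideanSpace.complexify ∘ v) k‖ₑ ^ 2 with ha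
  -- Parseval and the zero mode
  have hpars : ∑' k, a k = ENNReal.ofReal (∫ x, ‖v x‖ ^ 2) := by
    rw [ha, FunctionSpaces.Torus.tsum_enorm_sq_mFourierCoeff_complexify hv,
      Torus.lintegral_enorm_sq_eq_ofReal hv]
  have h0 : a 0 = ENNReal.ofReal (‖∫ x, v x‖ ^ 2) := by
    simp only [ha, mFourierCoeff_complexify_zero]
    rw [← ofReal_norm, FunctionSpaces.EuclideanSpace.norm_complexify,
      ENNReal.ofReal_pow (norm_nonneg _)]
  have hsplit : ∑' k, a k = a 0 + ∑' k, ite (k = 0) 0 (a k) :=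
    ENNReal.summable.tsum_eq_add_tsum_ite' (0 : d → ℤ)
  -- termwise comparison off the zero mode
  have hterm : ∀ k : d → ℤ,
      ite (k = 0) 0 (a k) ≤ ENNReal.ofReal (FunctionSpaces.Torus.freqNormSq k) * a k := by
    intro k
    split_ifs with hk
    · exact zero_le
    · calc a k = 1 * a k := (one_mul _).symm
        _ ≤ ENNReal.ofReal (FunctionSpaces.Torus.freqNormSq k) * a k := by
          gcongr
          rw [← ENNReal.ofReal_one]
          exact ENNReal.ofReal_le_ofReal (one_le_freqNormSq_of_ne_zero hk)
  have hsum : ∑' k, ite (k = 0) 0 (a k) ≤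
      ∑' k, ENNReal.ofReal (FunctionSpaces.Torus.freqNormSq k) * a k :=
    ENNReal.tsum_le_tsum hterm
  calc ENNReal.ofReal (4 * Real.pi ^ 2 * ∫ x, ‖v x‖ ^ 2)
      = ENNReal.ofReal (4 * Real.pi ^ 2) * ∑' k, a k := by
        rw [ENNReal.ofReal_mul (by positivity), hpars]
    _ = ENNReal.ofReal (4 * Real.pi ^ 2) * ∑' k, ite (k = 0) 0 (a k) +
          ENNReal.ofReal (4 * Real.pi ^ 2) * a 0 := by
        rw [hsplit, mul_add, add_comm]
    _ ≤ FunctionSpaces.Torus.eGradNormSq v + ENNReal.ofReal (4 * Real.pi ^ 2 * ‖∫ x, v x‖ ^ 2) := by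
        rw [FunctionSpaces.Torus.eGradNormSq_eq_tsum, h0, ← ENNReal.ofReal_mul (by positivity)]
        gcongr

end Poincare

/-! ### Constant fields and the steady force -/

section Const

variable [DecidableEq d]

omit [DecidableEq d] in
/-- The convective derivative of a constant field vanishes. [folklore] -/
theorem convect_fun_const (w : UnitAddTorus d → EuclideanSpace ℝ d) (e : EuclideanSpace ℝ d)
    (x : UnitAddTorus d) : FunctionSpaces.Torus.convect w (fun _ => e) x = 0 := by
  have h : FunctionSpaces.Torus.liftAt (fun _ : UnitAddTorus d => e) x = fun _ => e := rfl
  simp [FunctionSpaces.Torus.convect, FunctionSpaces.Torus.fderiv, h]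

omit [DecidableEq d] in
/-- The Laplacian of a constant field vanishes. [folklore] -/
theorem laplacian_fun_const (e : EuclideanSpace ℝ d) (x : UnitAddTorus d) :
    FunctionSpaces.Torus.laplacian (fun _ : UnitAddTorus d => e) x = 0 := by
  have h : FunctionSpaces.Torus.liftAt (fun _ : UnitAddTorus d => e) x = fun _ => e := rfl
  simp only [FunctionSpaces.Torus.laplacian, h]
  rw [InnerProductSpace.laplacian_const]
  rfl

/-- Constant fields are divergence free. [folklore] -/
theorem isDivFree_fun_const (e : EuclideanSpace ℝ d) :
    FunctionSpaces.Torus.IsDivFree (fun _ : UnitAddTorus d => e) := by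
  intro x
  simp [FunctionSpaces.Torus.divergence, FunctionSpaces.Torus.partialDeriv,
    FunctionSpaces.Torus.lineDeriv]

omit [DecidableEq d] in
/-- The space–time lift of a steady continuous field is (a.e.-strongly) measurable. [folklore] -/
theorem aestronglyMeasurable_stLift_steady {f : UnitAddTorus d → EuclideanSpace ℝ d}
    (hf : Continuous f) (μ : Measure (ℝ × EuclideanSpace ℝ d)) :
    AEStronglyMeasurable (FunctionSpaces.Torus.stLift (fun _ : ℝ => f)) μ := by
  have hc : Continuous (FunctionSpaces.Torus.stLift (fun _ : ℝ => f)) :=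
    hf.comp (FunctionSpaces.Torus.continuous_proj.comp continuous_snd)
  exact hc.aestronglyMeasurable

omit [DecidableEq d] in
/-- A steady `L²` field has finite space–time `L²` mass on every `(0, T) × T^d`. [folklore] -/
theorem lintegral_Ioo_lintegral_enorm_sq_steady_lt_top {f : UnitAddTorus d → EuclideanSpace ℝ d}
    (hf : MemLp f 2 volume) (T : ℝ) :
    ∫⁻ _ in Ioo (0 : ℝ) T, ∫⁻ x, ‖f x‖ₑ ^ 2 < ⊤ := by
  rw [setLIntegral_const, Torus.lintegral_enorm_sq_eq_ofReal hf]
  exact ENNReal.mul_lt_top ENNReal.ofReal_lt_top measure_Ioo_lt_top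

/-- The Doering–Foias force `F Φ(n • ·)` is smooth
(`ForcingShape.force_regular_holds`). [folklore] -/
theorem ForcingShape.isSmooth_force (Φ : ForcingShape d) {n : ℕ} (hn : 0 < n) (F : ℝ) :
    FunctionSpaces.Torus.IsSmooth (Φ.force n F) :=
  (ForcingShape.force_regular_holds Φ hn F).1

/-- The Doering–Foias force `F Φ(n • ·)` has zero mean
(`ForcingShape.force_regular_holds`). [folklore] -/
theorem ForcingShape.hasZeroMean_force (Φ : ForcingShape d) {n : ℕ} (hn : 0 < n) (F : ℝ) :
    FunctionSpaces.Torus.HasZeroMean (Φ.force n F) :=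
  (ForcingShape.force_regular_holds Φ hn F).2.2

/-- **Cauchy–Schwarz for the injected power density**: `|∫ ⟪f, w⟫| ≤ |F| ‖w‖₂` for the
Doering–Foias force `f = F Φ(n • ·)`, since `‖f‖₂ = |F|` (`ForcingShape.integral_norm_sq_force`)
(Cheskidov–Doering–Petrov 2007, display before eq. (17), `α = 0`). [cite: CheskidovDoeringPetrov2006, eq. (17)] -/
theorem ForcingShape.abs_integral_inner_force_le (Φ : ForcingShape d) {n : ℕ} (hn : 0 < n)
    (F : ℝ) {w : UnitAddTorus d → EuclideanSpace ℝ d} (hw : MemLp w 2 volume) :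
    |∫ x, ⟪Φ.force n F x, w x⟫| ≤ |F| * Real.sqrt (∫ x, ‖w x‖ ^ 2) := by
  have h := abs_integral_inner_le_sqrt_mul_sqrt ((Φ.isSmooth_force hn F).memLp 2) hw
  rwa [ForcingShape.integral_norm_sq_force_holds Φ hn F, Real.sqrt_sq_eq_abs] at h

end Const

/-! ### Conservation of the mean flow -/

section Mean

variable [DecidableEq d] {ν : ℝ} {f : UnitAddTorus d → EuclideanSpace ℝ d}
  {u₀ : UnitAddTorus d → EuclideanSpace ℝ d} {u : ℝ → UnitAddTorus d → EuclideanSpace ℝ d}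

/-- **The mean flow is conserved.** For a global Leray–Hopf solution on `T^d` driven by a steady
smooth mean-zero force, `∫ ⟪u(t), e⟫ = ∫ ⟪u₀, e⟫` for every constant vector `e` and every
`t > 0`: the time-sliced weak formulation (`Torus.IsLerayHopfOn.integral_inner_eq_add_setIntegral`,
Temam 1984, Ch. III (1.25)) tested with the constant (smooth, divergence-free) field `e`, whose
convective and viscous terms vanish, while `∫ ⟪f, e⟫ = ⟪∫ f, e⟫ = 0`. [folklore] -/
theorem Torus.IsGlobalLerayHopf.integral_inner_const_eq (hf : FunctionSpaces.Torus.IsSmooth f)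
    (hf0 : FunctionSpaces.Torus.HasZeroMean f) (hu : Torus.IsGlobalLerayHopf ν (fun _ => f) u₀ u)
    (e : EuclideanSpace ℝ d) {t : ℝ} (ht : 0 < t) :
    ∫ x, ⟪u t x, e⟫ = ∫ x, ⟪u₀ x, e⟫ := by
  have h := (hu t ht).integral_inner_eq_add_setIntegral ht
    (aestronglyMeasurable_stLift_steady hf.continuous _)
    (lintegral_Ioo_lintegral_enorm_sq_steady_lt_top (hf.memLp 2) t)
    (FunctionSpaces.Torus.isSmooth_const e) (isDivFree_fun_const e) ⟨ht, le_rfl⟩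
  rw [h]
  have hflux : ∀ s, ∫ x, (⟪u s x, FunctionSpaces.Torus.convect (u s) (fun _ => e) x⟫ +
      ν * ⟪u s x, FunctionSpaces.Torus.laplacian (fun _ : UnitAddTorus d => e) x⟫ +
        ⟪f x, e⟫) = 0 := by
    intro s
    have hpt : (fun x => ⟪u s x, FunctionSpaces.Torus.convect (u s) (fun _ => e) x⟫ +
        ν * ⟪u s x, FunctionSpaces.Torus.laplacian (fun _ : UnitAddTorus d => e) x⟫ + ⟪f x, e⟫) =
        fun x => ⟪e, f x⟫ := by
      funext x
      rw [convect_fun_const, laplacian_fun_const, inner_zero_right, mul_zero, zero_add, zero_add]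
      exact real_inner_comm _ _
    rw [hpt, integral_inner hf.integrable e, hf0, inner_zero_right]
  simp [hflux]

/-- Vector form of mean conservation: `∫ u(t) = ∫ u(s)` for all `s, t > 0`. [folklore] -/
theorem Torus.IsGlobalLerayHopf.integral_eq_integral (hf : FunctionSpaces.Torus.IsSmooth f)
    (hf0 : FunctionSpaces.Torus.HasZeroMean f) (hu : Torus.IsGlobalLerayHopf ν (fun _ => f) u₀ u)
    {s t : ℝ} (hs : 0 < s) (ht : 0 < t) :
    ∫ x, u t x = ∫ x, u s x := by
  have hti : Integrable (u t) volume := (hu.memLp_two ht.le).integrable one_le_two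
  have hsi : Integrable (u s) volume := (hu.memLp_two hs.le).integrable one_le_two
  refine ext_inner_left ℝ fun e => ?_
  rw [← integral_inner hti e, ← integral_inner hsi e]
  have h1 := hu.integral_inner_const_eq hf hf0 e ht
  have h2 := hu.integral_inner_const_eq hf hf0 e hs
  simp_rw [real_inner_comm e] at h1 h2
  rw [h1, h2]

end Mean


/-! ### Two elementary inequalities -/

section Algebra

/-- Weighted AM–GM: `a b ≤ c b² + a²/(4c)` for `c > 0` (`(2cb - a)² ≥ 0`). [folklore] -/
theorem mul_le_mul_sq_add_sq_div {a b c : ℝ} (hc : 0 < c) :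
    a * b ≤ c * b ^ 2 + a ^ 2 / (4 * c) := by
  have h : c * b ^ 2 + a ^ 2 / (4 * c) - a * b = (2 * c * b - a) ^ 2 / (4 * c) := by
    field_simp
    ring
  have h' : 0 ≤ (2 * c * b - a) ^ 2 / (4 * c) := by positivity
  linarith

/-- Optimising `x ≤ c (B/(2a) + a/2)` over `a > 0` gives `x ≤ c √B` (`c, B ≥ 0`; take `a = √B`,
resp. `a → 0⁺` when `B = 0`). [folklore] -/
theorem le_mul_sqrt_of_forall_pos {x c B : ℝ} (hc : 0 ≤ c) (hB : 0 ≤ B)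
    (h : ∀ a : ℝ, 0 < a → x ≤ c * (B / (2 * a) + a / 2)) : x ≤ c * Real.sqrt B := by
  rcases hB.eq_or_lt with hB0 | hBpos
  · rw [← hB0, Real.sqrt_zero, mul_zero]
    refine le_of_forall_pos_le_add fun ε hε => ?_
    have ha : 0 < 2 * ε / (c + 1) := by positivity
    have h1 := h _ ha
    rw [← hB0, zero_div, zero_add] at h1
    have h2 : c * (2 * ε / (c + 1) / 2) = ε * (c / (c + 1)) := by
      field_simp
    have h3 : c / (c + 1) ≤ 1 := (div_le_one (by positivity)).2 (by linarith)
    calc x ≤ c * (2 * ε / (c + 1) / 2) := h1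
      _ = ε * (c / (c + 1)) := h2
      _ ≤ ε * 1 := by gcongr
      _ = 0 + ε := by ring
  · have ha : 0 < Real.sqrt B := Real.sqrt_pos.2 hBpos
    have hs : Real.sqrt B * Real.sqrt B = B := Real.mul_self_sqrt hB
    have hne : Real.sqrt B ≠ 0 := ha.ne'
    calc x ≤ c * (B / (2 * Real.sqrt B) + Real.sqrt B / 2) := h _ ha
      _ = c * Real.sqrt B := by
        congr 1
        field_simp
        nlinarith [hs]

end Algebra

/-! ### A uniform bound on the Cesàro means of the energy -/

section EnergyBound

variable [DecidableEq d] {ν : ℝ} {f : UnitAddTorus d → EuclideanSpace ℝ d}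
  {u₀ : UnitAddTorus d → EuclideanSpace ℝ d} {u : ℝ → UnitAddTorus d → EuclideanSpace ℝ d}

/-- **Integrated Poincaré inequality along a Leray–Hopf solution** (steady smooth mean-zero
force): for `t > 0`,
`4π² ∫₀ᵗ ‖u(τ)‖₂² dτ ≤ ∫₀ᵗ ‖∇u(τ)‖₂² dτ + 4π² ‖ū‖² t`,
where `ū = ∫ u(1)` is the (conserved) mean flow and the dissipation is the spectral
`∫⁻ eGradNormSq` of the energy inequality (finite, `Torus.IsLerayHopfOn.lintegral_eGradNormSq_lt_top`)
(Doering–Foias 2002, §2; Cheskidov–Doering–Petrov 2007, eq. (12)). [folklore] -/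
theorem Torus.IsGlobalLerayHopf.intervalIntegral_norm_sq_le_dissipation
    (hf : FunctionSpaces.Torus.IsSmooth f) (hf0 : FunctionSpaces.Torus.HasZeroMean f)
    (hu : Torus.IsGlobalLerayHopf ν (fun _ => f) u₀ u) {t : ℝ} (ht : 0 < t) :
    4 * Real.pi ^ 2 * ∫ τ in (0 : ℝ)..t, ∫ x, ‖u τ x‖ ^ 2 ≤
      (∫⁻ τ in Ioo 0 t, FunctionSpaces.Torus.eGradNormSq (u τ)).toReal +
        4 * Real.pi ^ 2 * ‖∫ x, u 1 x‖ ^ 2 * t := by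
  set M : ℝ := ‖∫ x, u 1 x‖ ^ 2 with hM
  set C : ℝ≥0∞ := ENNReal.ofReal (4 * Real.pi ^ 2 * M) with hC
  -- pointwise Poincaré with the conserved mean
  have hpt : ∀ τ ∈ Ioo 0 t, ENNReal.ofReal (4 * Real.pi ^ 2 * ∫ x, ‖u τ x‖ ^ 2) ≤
      FunctionSpaces.Torus.eGradNormSq (u τ) + C := by
    intro τ hτ
    have h := ofReal_integral_norm_sq_le_eGradNormSq_add (hu.memLp_two hτ.1.le)
    rwa [hu.integral_eq_integral hf hf0 zero_lt_one hτ.1] at h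
  have hint : IntegrableOn (fun τ => ∫ x, ‖u τ x‖ ^ 2) (Ioo 0 t) :=
    (hu t ht).integrableOn_integral_norm_sq
  have hI0 : 0 ≤ ∫ τ in (0 : ℝ)..t, ∫ x, ‖u τ x‖ ^ 2 :=
    intervalIntegral.integral_nonneg ht.le fun τ _ => integral_nonneg fun _ => sq_nonneg _
  have h1 : ∫⁻ τ in Ioo 0 t, ENNReal.ofReal (4 * Real.pi ^ 2 * ∫ x, ‖u τ x‖ ^ 2) =
      ENNReal.ofReal (4 * Real.pi ^ 2 * ∫ τ in (0 : ℝ)..t, ∫ x, ‖u τ x‖ ^ 2) := by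
    rw [intervalIntegral.integral_of_le ht.le, integral_Ioc_eq_integral_Ioo, ← integral_const_mul,
      ofReal_integral_eq_lintegral_ofReal (hint.const_mul _)
        (ae_of_all _ fun τ => mul_nonneg (by positivity) (integral_nonneg fun _ => sq_nonneg _))]
  have h2 : ∫⁻ τ in Ioo 0 t, ENNReal.ofReal (4 * Real.pi ^ 2 * ∫ x, ‖u τ x‖ ^ 2) ≤
      (∫⁻ τ in Ioo 0 t, FunctionSpaces.Torus.eGradNormSq (u τ)) + C * volume (Ioo (0 : ℝ) t) := by
    calc ∫⁻ τ in Ioo 0 t, ENNReal.ofReal (4 * Real.pi ^ 2 * ∫ x, ‖u τ x‖ ^ 2)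
        ≤ ∫⁻ τ in Ioo 0 t, (FunctionSpaces.Torus.eGradNormSq (u τ) + C) :=
          setLIntegral_mono' measurableSet_Ioo hpt
      _ = (∫⁻ τ in Ioo 0 t, FunctionSpaces.Torus.eGradNormSq (u τ)) +
            C * volume (Ioo (0 : ℝ) t) := by
          rw [lintegral_add_right _ measurable_const, setLIntegral_const]
  have hfin : ∫⁻ τ in Ioo 0 t, FunctionSpaces.Torus.eGradNormSq (u τ) < ⊤ :=
    (hu t ht).lintegral_eGradNormSq_lt_top
  have hCt : C * volume (Ioo (0 : ℝ) t) = ENNReal.ofReal (4 * Real.pi ^ 2 * M * t) := by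
    rw [Real.volume_Ioo, sub_zero, hC, ← ENNReal.ofReal_mul (by positivity)]
  rw [h1, hCt] at h2
  have h3 := ENNReal.toReal_mono (ENNReal.add_ne_top.2 ⟨hfin.ne, ENNReal.ofReal_ne_top⟩) h2
  rwa [ENNReal.toReal_ofReal (by positivity), ENNReal.toReal_add hfin.ne ENNReal.ofReal_ne_top,
    ENNReal.toReal_ofReal (by positivity)] at h3

/-- **Linear-in-time bound on the integrated energy.** For a global Leray–Hopf solution on `T^d`
driven by a steady smooth mean-zero force `f` (viscosity `ν > 0`), for every `t > 0`
`∫₀ᵗ ‖u(τ)‖₂² dτ ≤ ½‖u₀‖₂²/(2π²ν) + (2‖ū‖² + ‖f‖₂²/(16π⁴ν²)) t`: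
the energy inequality from `0` (`½‖u(t)‖₂² + ν∫₀ᵗ‖∇u‖₂² ≤ ½‖u₀‖₂² + ∫₀ᵗ ⟨f, u⟩`), the work bound
`⟨f, u⟩ ≤ ‖f‖₂ ‖u‖₂ ≤ 2π²ν ‖u‖₂² + ‖f‖₂²/(8π²ν)` (Cauchy–Schwarz and Young) and the integrated
Poincaré inequality `intervalIntegral_norm_sq_le_dissipation` (Doering–Foias 2002, §2: the
standard a-priori energy estimate behind the finiteness of `U`). [folklore] -/
theorem Torus.IsGlobalLerayHopf.intervalIntegral_norm_sq_le (hν : 0 < ν)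
    (hf : FunctionSpaces.Torus.IsSmooth f) (hf0 : FunctionSpaces.Torus.HasZeroMean f)
    (hu : Torus.IsGlobalLerayHopf ν (fun _ => f) u₀ u) {t : ℝ} (ht : 0 < t) :
    ∫ τ in (0 : ℝ)..t, ∫ x, ‖u τ x‖ ^ 2 ≤
      FunctionSpaces.Torus.kineticEnergy u₀ / (2 * Real.pi ^ 2 * ν) +
        (2 * ‖∫ x, u 1 x‖ ^ 2 + (∫ x, ‖f x‖ ^ 2) / (16 * Real.pi ^ 4 * ν ^ 2)) * t := by
  set E : ℝ → ℝ := fun τ => ∫ x, ‖u τ x‖ ^ 2 with hEdef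
  set P : ℝ → ℝ := fun τ => ∫ x, ⟪f x, u τ x⟫ with hPdef
  set A2 : ℝ := ∫ x, ‖f x‖ ^ 2 with hA2
  set M : ℝ := ‖∫ x, u 1 x‖ ^ 2 with hM
  set D : ℝ := (∫⁻ τ in Ioo 0 t, FunctionSpaces.Torus.eGradNormSq (u τ)).toReal with hD
  have hc : 0 < 2 * Real.pi ^ 2 * ν := by positivity
  have hA2_0 : 0 ≤ A2 := integral_nonneg fun _ => sq_nonneg _
  have hE0 : ∀ τ, 0 ≤ E τ := fun τ => integral_nonneg fun _ => sq_nonneg _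
  -- the energy inequality from `0` at time `t`
  have hE : FunctionSpaces.Torus.kineticEnergy (u t) + ν * D ≤
      FunctionSpaces.Torus.kineticEnergy u₀ + ∫ τ in (0 : ℝ)..t, P τ :=
    (hu t ht).energy_ineq_zero t ⟨ht.le, le_rfl⟩
  -- integrability in time of the energy and of the work
  have hEint : IntervalIntegrable E volume 0 t :=
    (intervalIntegrable_iff_integrableOn_Ioc_of_le ht.le).2 (hu.integrableOn_integral_norm_sq ht)
  have hPint : IntervalIntegrable P volume 0 t := by
    have h1 : IntegrableOn (fun s => ∫ x, ⟪u s x, f x⟫) (Ioo 0 t) :=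
      (hu t ht).integrableOn_integral_inner hf.continuous
    have h2 : P = fun s => ∫ x, ⟪u s x, f x⟫ := by
      funext s
      exact integral_congr_ae (ae_of_all _ fun x => real_inner_comm _ _)
    rw [intervalIntegrable_iff_integrableOn_Ioc_of_le ht.le, h2]
    exact (integrableOn_Ioc_iff_integrableOn_Ioo).mpr h1
  -- the work bound, pointwise and integrated
  have hwork : ∫ τ in (0 : ℝ)..t, P τ ≤
      ∫ τ in (0 : ℝ)..t, (2 * Real.pi ^ 2 * ν * E τ + A2 / (4 * (2 * Real.pi ^ 2 * ν))) := by
    refine intervalIntegral.integral_mono_on ht.le hPint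
      ((hEint.const_mul _).add _root_.intervalIntegrable_const) fun τ hτ => ?_
    have hcs := abs_integral_inner_le_sqrt_mul_sqrt (hf.memLp 2) (hu.memLp_two hτ.1)
    have hyoung := mul_le_mul_sq_add_sq_div (a := Real.sqrt A2) (b := Real.sqrt (E τ)) hc
    rw [Real.sq_sqrt (hE0 τ), Real.sq_sqrt hA2_0] at hyoung
    exact (le_abs_self _).trans (hcs.trans hyoung)
  rw [intervalIntegral.integral_add (hEint.const_mul _) _root_.intervalIntegrable_const,
    intervalIntegral.integral_const_mul, intervalIntegral.integral_const, sub_zero,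
    smul_eq_mul] at hwork
  -- the integrated Poincaré inequality
  have hA := hu.intervalIntegral_norm_sq_le_dissipation hf hf0 ht
  have hKt : 0 ≤ FunctionSpaces.Torus.kineticEnergy (u t) :=
    FunctionSpaces.Torus.kineticEnergy_nonneg _
  -- algebra
  have h4 : 2 * Real.pi ^ 2 * ν * ∫ τ in (0 : ℝ)..t, E τ ≤
      FunctionSpaces.Torus.kineticEnergy u₀ +
        (4 * Real.pi ^ 2 * ν * M + A2 / (4 * (2 * Real.pi ^ 2 * ν))) * t := by
    have hA' := mul_le_mul_of_nonneg_left hA hν.le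
    nlinarith
  have hrhs : FunctionSpaces.Torus.kineticEnergy u₀ / (2 * Real.pi ^ 2 * ν) +
      (2 * M + A2 / (16 * Real.pi ^ 4 * ν ^ 2)) * t =
      (FunctionSpaces.Torus.kineticEnergy u₀ +
        (4 * Real.pi ^ 2 * ν * M + A2 / (4 * (2 * Real.pi ^ 2 * ν))) * t) /
        (2 * Real.pi ^ 2 * ν) := by
    field_simp
    ring
  rw [hrhs, le_div_iff₀ hc]
  linarith

/-- **Uniform bound on the Cesàro means of the energy**: for `T ≥ 1`,
`T⁻¹ ∫₀ᵀ ‖u(t)‖₂² dt ≤ ½‖u₀‖₂²/(2π²ν) + 2‖ū‖² + ‖f‖₂²/(16π⁴ν²)`; in particular the long-time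
average `⟨‖u‖₂²⟩ = U²` is an honest (bounded) `limsup` (Doering–Foias 2002, §2). [folklore] -/
theorem Torus.IsGlobalLerayHopf.timeMean_norm_sq_le (hν : 0 < ν)
    (hf : FunctionSpaces.Torus.IsSmooth f) (hf0 : FunctionSpaces.Torus.HasZeroMean f)
    (hu : Torus.IsGlobalLerayHopf ν (fun _ => f) u₀ u) {T : ℝ} (hT : 1 ≤ T) :
    timeMean (fun t => ∫ x, ‖u t x‖ ^ 2) T ≤
      FunctionSpaces.Torus.kineticEnergy u₀ / (2 * Real.pi ^ 2 * ν) +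
        (2 * ‖∫ x, u 1 x‖ ^ 2 + (∫ x, ‖f x‖ ^ 2) / (16 * Real.pi ^ 4 * ν ^ 2)) := by
  have hT0 : 0 < T := by linarith
  have h := hu.intervalIntegral_norm_sq_le hν hf hf0 hT0
  have hK0 : 0 ≤ FunctionSpaces.Torus.kineticEnergy u₀ / (2 * Real.pi ^ 2 * ν) :=
    div_nonneg (FunctionSpaces.Torus.kineticEnergy_nonneg _) (by positivity)
  have hK1 : 0 ≤ 2 * ‖∫ x, u 1 x‖ ^ 2 + (∫ x, ‖f x‖ ^ 2) / (16 * Real.pi ^ 4 * ν ^ 2) := by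
    have : 0 ≤ ∫ x, ‖f x‖ ^ 2 := integral_nonneg fun _ => sq_nonneg _
    positivity
  unfold timeMean
  rw [inv_mul_le_iff₀ hT0]
  nlinarith

end EnergyBound

/-! ### The power bound -/

section Power

variable [DecidableEq d] {ν : ℝ} {f : UnitAddTorus d → EuclideanSpace ℝ d}
  {u₀ : UnitAddTorus d → EuclideanSpace ℝ d} {u : ℝ → UnitAddTorus d → EuclideanSpace ℝ d}

/-- **Cauchy–Schwarz in space and Jensen in time**: for a global Leray–Hopf solution driven by
the steady smooth force `f` and every `T > 0`,
`|T⁻¹ ∫₀ᵀ ⟨f, u(t)⟩ dt| ≤ ‖f‖₂ (T⁻¹ ∫₀ᵀ ‖u(t)‖₂² dt)^{1/2}`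
(Cheskidov–Doering–Petrov 2007, display before eq. (17) and Jensen's inequality (J1);
Doering–Foias 2002, §2). [cite: CheskidovDoeringPetrov2006, eq. (17)] -/
theorem Torus.IsGlobalLerayHopf.abs_timeMean_power_le (hf : FunctionSpaces.Torus.IsSmooth f)
    (hu : Torus.IsGlobalLerayHopf ν (fun _ => f) u₀ u) {T : ℝ} (hT : 0 < T) :
    |timeMean (fun t => ∫ x, ⟪f x, u t x⟫) T| ≤
      Real.sqrt (∫ x, ‖f x‖ ^ 2) * Real.sqrt (timeMean (fun t => ∫ x, ‖u t x‖ ^ 2) T) := by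
  set E : ℝ → ℝ := fun τ => ∫ x, ‖u τ x‖ ^ 2 with hEdef
  set P : ℝ → ℝ := fun τ => ∫ x, ⟪f x, u τ x⟫ with hPdef
  set A : ℝ := Real.sqrt (∫ x, ‖f x‖ ^ 2) with hA
  have hA0 : 0 ≤ A := Real.sqrt_nonneg _
  have hE0 : ∀ τ, 0 ≤ E τ := fun τ => integral_nonneg fun _ => sq_nonneg _
  have hEint : IntervalIntegrable E volume 0 T :=
    (intervalIntegrable_iff_integrableOn_Ioc_of_le hT.le).2 (hu.integrableOn_integral_norm_sq hT)
  have hPint : IntervalIntegrable P volume 0 T := by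
    have h1 : IntegrableOn (fun s => ∫ x, ⟪u s x, f x⟫) (Ioo 0 T) :=
      (hu T hT).integrableOn_integral_inner hf.continuous
    have h2 : P = fun s => ∫ x, ⟪u s x, f x⟫ := by
      funext s
      exact integral_congr_ae (ae_of_all _ fun x => real_inner_comm _ _)
    rw [intervalIntegrable_iff_integrableOn_Ioc_of_le hT.le, h2]
    exact (integrableOn_Ioc_iff_integrableOn_Ioo).mpr h1
  refine le_mul_sqrt_of_forall_pos hA0 (timeMean_nonneg hE0 hT.le) fun a ha => ?_
  -- `|P| ≤ A √E ≤ A (E/(2a) + a/2)` pointwise, integrated over `[0, T]`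
  have hmono : ∫ τ in (0 : ℝ)..T, |P τ| ≤ ∫ τ in (0 : ℝ)..T, A * (E τ / (2 * a) + a / 2) := by
    refine intervalIntegral.integral_mono_on hT.le hPint.abs
      (((hEint.div_const _).add _root_.intervalIntegrable_const).const_mul A) fun τ hτ => ?_
    have hcs : |P τ| ≤ A * Real.sqrt (E τ) :=
      abs_integral_inner_le_sqrt_mul_sqrt (hf.memLp 2) (hu.memLp_two hτ.1)
    refine hcs.trans (mul_le_mul_of_nonneg_left ?_ hA0)
    have hsq : Real.sqrt (E τ) ^ 2 = E τ := Real.sq_sqrt (hE0 τ)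
    have hid : E τ / (2 * a) + a / 2 = (Real.sqrt (E τ) ^ 2 + a ^ 2) / (2 * a) := by
      rw [hsq]
      field_simp
    rw [hid, le_div_iff₀ (by positivity)]
    nlinarith [sq_nonneg (Real.sqrt (E τ) - a)]
  rw [intervalIntegral.integral_const_mul,
    intervalIntegral.integral_add (hEint.div_const _) _root_.intervalIntegrable_const,
    intervalIntegral.integral_div, intervalIntegral.integral_const, sub_zero, smul_eq_mul] at hmono
  have habs : |∫ τ in (0 : ℝ)..T, P τ| ≤ ∫ τ in (0 : ℝ)..T, |P τ| :=
    intervalIntegral.abs_integral_le_integral_abs hT.le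
  unfold timeMean
  rw [abs_mul, abs_of_pos (inv_pos.2 hT)]
  calc T⁻¹ * |∫ τ in (0 : ℝ)..T, P τ|
      ≤ T⁻¹ * (A * ((∫ τ in (0 : ℝ)..T, E τ) / (2 * a) + T * (a / 2))) :=
        mul_le_mul_of_nonneg_left (habs.trans hmono) (inv_nonneg.2 hT.le)
    _ = A * (T⁻¹ * (∫ τ in (0 : ℝ)..T, E τ) / (2 * a) + a / 2) := by
        field_simp

/-- **The power bound `⟨f·u⟩ ≤ ‖f‖₂ U` for a steady smooth mean-zero force** on `T^d`
(`limsup` averages): `meanPower f u ≤ ‖f‖₂ · rmsVelocity longTimeAvgSup u` for every global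
Leray–Hopf solution (Cheskidov–Doering–Petrov 2007, eq. (17) with `α = 0`; Doering–Foias 2002,
§2). The Cesàro means of the energy are bounded (`timeMean_norm_sq_le`), so `U² = limsup` is
honest and `limsup` commutes with the monotone continuous `y ↦ ‖f‖₂ √y`. [cite: CheskidovDoeringPetrov2006, eq. (17)] -/
theorem Torus.IsGlobalLerayHopf.meanPower_le (hν : 0 < ν) (hf : FunctionSpaces.Torus.IsSmooth f)
    (hf0 : FunctionSpaces.Torus.HasZeroMean f) (hu : Torus.IsGlobalLerayHopf ν (fun _ => f) u₀ u) :
    meanPower f u ≤ Real.sqrt (∫ x, ‖f x‖ ^ 2) * rmsVelocity longTimeAvgSup u := by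
  unfold meanPower rmsVelocity meanSqVelocity longTimeAvgSup
  set E : ℝ → ℝ := fun τ => ∫ x, ‖u τ x‖ ^ 2 with hEdef
  set P : ℝ → ℝ := fun τ => ∫ x, ⟪f x, u τ x⟫ with hPdef
  set A : ℝ := Real.sqrt (∫ x, ‖f x‖ ^ 2) with hA
  set K : ℝ := FunctionSpaces.Torus.kineticEnergy u₀ / (2 * Real.pi ^ 2 * ν) +
    (2 * ‖∫ x, u 1 x‖ ^ 2 + (∫ x, ‖f x‖ ^ 2) / (16 * Real.pi ^ 4 * ν ^ 2)) with hK
  set g : ℝ → ℝ := fun y => A * Real.sqrt y with hg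
  have hA0 : 0 ≤ A := Real.sqrt_nonneg _
  have hE0 : ∀ τ, 0 ≤ E τ := fun τ => integral_nonneg fun _ => sq_nonneg _
  have hg_mono : Monotone g := fun x y hxy =>
    mul_le_mul_of_nonneg_left (Real.sqrt_le_sqrt hxy) hA0
  have hg_cont : Continuous g := continuous_const.mul Real.continuous_sqrt
  -- pointwise bounds and boundedness of the Cesàro means of the energy
  have hpt : ∀ T, 0 < T → |timeMean P T| ≤ g (timeMean E T) := fun T hT =>
    hu.abs_timeMean_power_le hf hT
  have hBK : ∀ᶠ T in atTop, timeMean E T ≤ K :=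
    eventually_atTop.2 ⟨1, fun T hT => hu.timeMean_norm_sq_le hν hf hf0 hT⟩
  have hB0 : ∀ᶠ T in atTop, 0 ≤ timeMean E T :=
    (eventually_ge_atTop 0).mono fun T hT => timeMean_nonneg hE0 hT
  have hBbdd : IsBoundedUnder (· ≤ ·) atTop (timeMean E) := isBoundedUnder_of_eventually_le hBK
  have hBcobdd : IsCoboundedUnder (· ≤ ·) atTop (timeMean E) :=
    isCoboundedUnder_le_of_eventually_le atTop hB0
  -- comparison of the `limsup`s
  have h1 : limsup (timeMean P) atTop ≤ limsup (g ∘ timeMean E) atTop := by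
    refine limsup_le_limsup ?_ ?_ ?_
    · filter_upwards [eventually_gt_atTop 0] with T hT using (le_abs_self _).trans (hpt T hT)
    · refine isCoboundedUnder_le_of_eventually_le atTop (x := -g K) ?_
      filter_upwards [eventually_gt_atTop 0, hBK] with T hT hTK
      have h := (neg_abs_le _).trans' (neg_le_neg ((hpt T hT).trans (hg_mono hTK)))
      exact h
    · exact isBoundedUnder_of_eventually_le (a := g K) (hBK.mono fun T hTK => hg_mono hTK)
  have h2 : limsup (g ∘ timeMean E) atTop = g (limsup (timeMean E) atTop) :=
    (hg_mono.map_limsup_of_continuousAt (timeMean E) hg_cont.continuousAt hBbdd hBcobdd).symm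
  rw [h2] at h1
  exact h1

end Power

/-! ### Discharge of `DoeringFoias2002_power_le` -/

/-- **Discharge of `DoeringFoias2002_power_le`** (Cheskidov–Doering–Petrov 2007, eq. (17) with
`α = 0`: `⟨f·u⟩ ≤ |F| U`; Doering–Foias 2002, §2): apply `Torus.IsGlobalLerayHopf.meanPower_le`
to the Doering–Foias force `f = F Φ(n • ·)`, which is smooth and mean zero
(`ForcingShape.force_regular_holds`) with `‖f‖₂ = |F|` (`ForcingShape.integral_norm_sq_force_holds`). [cite: CheskidovDoeringPetrov2006, eq. (17)] -/
theorem DoeringFoias2002_power_le_holds : DoeringFoias2002_power_le := by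
  intro Φ ν hν n hn F u₀ u hu
  have h := Torus.IsGlobalLerayHopf.meanPower_le hν (Φ.isSmooth_force hn F)
    (Φ.hasZeroMean_force hn F) hu
  rwa [ForcingShape.integral_norm_sq_force_holds Φ hn F, Real.sqrt_sq_eq_abs] at h

end Literature.Analysis.FluidPDE
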